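import Literature.AlgebraicGeometry.HodgeTheory.MaxRationalSubHodgeStructureSupportedHodgeClasses
import HarnessLib

/-!
# `GHC(X, 2q, q − 1) ⟹ GHC(X, 2q, q)`: Grothendieck's amended general Hodge conjecture OFF the diagonal implies
# the Hodge conjecture; the off-diagonal lower window; fourfolds and fivefolds

Family `hodge`, layer `Literature/AlgebraicGeometry/HodgeTheory`; lane `lit-hodgefound` (Track 2 foundations,
Layer A1/A4). THEOREMS ONLY (no definition, no named fact; D-0026). Sequel of
`MaxRationalSubHodgeStructureSupportedHodgeClasses` (`max(X, 2q, q) ∩ N^{q−1} H^{2q}(X) ⊆ N^q H^{2q}(X)`: the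
Hodge classes of coniveau `≥ q − 1` are algebraic — Voisin 2013 Lemma 2.1 in Grothendieck's language) and of
`MaxRationalSubHodgeStructureHardLefschetz` (the lower window `1 ≤ r`, `2r ≤ i ≤ dim X`, `i < dim X + r`).

Sources, VERBATIM. A. Grothendieck, *Hodge's general conjecture is false for trivial reasons*, Topology 8 (1969),
p. 300 (the amended conjecture: the largest rational sub-Hodge structure of `Fʳ Hᵏ` is supported in codimension
`r`) and p. 301: «for `i = 2p`, the Hodge conjecture (which need in this case not be corrected) is just the usual
Hodge conjecture, characterizing algebraic cohomology classes». C. Voisin, Ann. Sci. ÉNS 46 (2013), p. 6: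
«Lemma 2.1. Conjecture 1.2 is satisfied by codimension `k` cycles whose cohomology class vanishes away from a
codimension `k − 1` closed algebraic subset […] the classes `αᵢ` are cycle classes on `Ỹᵢ` by the Lefschetz
theorem on `(1,1)`-classes». C. Voisin, J. Open Math. Probl. 1 (2025), §4.3 first paragraph: «In order to solve
the generalized Hodge conjecture for `L`, we can assume that `k ≤ n = dim X`, by the hard Lefschetz
isomorphism». J. Murre, *Algebraic cycles and algebraic aspects of cohomology and K-theory* (Torino 1994),
§5.7–§5.8 (the known cases `(2, 1)`, top degrees).

## The mathematics

The admissible subspaces of `(H^{2q}, F^q)` are admissible for `F^{q−1}`, so `max(X, 2q, q) ⊆ max(X, 2q, q − 1)`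
(`HodgeModel.maxRatSubHodgeInFilt_mono`). If `GHC(X, 2q, q − 1)` holds, `max(X, 2q, q − 1) ⊆ N^{q−1} H^{2q}`, hence
`max(X, 2q, q) = max(X, 2q, q) ∩ N^{q−1} ⊆ N^q` by the prequel: **`GHC(X, 2q, q − 1) ⟹ GHC(X, 2q, q)`** — the case
`(2q, q − 1)` of Grothendieck's conjecture implies the Hodge conjecture in codimension `q`. Consequently the
diagonal cells `(2q, q)`, `q ≥ 2`, of the lower window are implied by the off-diagonal cells `(2q, q − 1)` (which
belong to the lower window whenever `(2q, q)` does and `q ≥ 2`), and `(2, 1)` is Lefschetz `(1,1)`: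
**Grothendieck's conjecture for `X` in all bidegrees is equivalent to its OFF-DIAGONAL lower-window cases
`1 ≤ r`, `2r < i ≤ dim X`, `i < dim X + r`** — the Hodge conjecture proper never needs to be checked separately.
Fourfolds: `GHC(X, 3, 1) ∧ GHC(X, 4, 1)`; fivefolds: `GHC(X, 3, 1) ∧ GHC(X, 4, 1) ∧ GHC(X, 5, 1) ∧ GHC(X, 5, 2)`;
and for every `X`, `GHC(X, 4, 1) ⟹` the Hodge conjecture for codimension-`2` cycles.

## What is proved

* §1 **`GeneralHodgePropertyFor.of_pred_level`** (`GHC(X, 2q, q − 1) ⟹ GHC(X, 2q, q)`),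
  `hodgeConjectureFor_of_forall_generalHodgePropertyFor_pred` (`(∀ p, GHC(X, 2p + 2, p)) ⟹ HC(X)`),
  `generalHodgePropertyFor_four_two_of_four_one` (codimension-`2` cycles from `GHC(X, 4, 1)`).
* §2 **`forall_generalHodgePropertyFor_iff_offDiagonal_lower_window`** (all bidegrees ⟺ the cells `1 ≤ r`,
  `2r < i ≤ n`, `i < n + r`).
* §3 **`forall_generalHodgePropertyFor_dim_four_iff'`** (fourfolds: `⟺ GHC(3, 1) ∧ GHC(4, 1)`),
  `hodgeConjectureFor_of_generalHodgePropertyFor_four_one` (fourfolds: `GHC(4, 1) ⟹ HC`),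
  **`forall_generalHodgePropertyFor_dim_five_iff`** (fivefolds: `⟺ GHC(3,1) ∧ GHC(4,1) ∧ GHC(5,1) ∧ GHC(5,2)`),
  `hodgeConjectureFor_of_generalHodgePropertyFor_four_one_of_dim_five` (fivefolds: `GHC(4, 1) ⟹ HC`, the
  codimension-`3` classes being the hard-Lefschetz images of the codimension-`2` ones).

## References

* [GrothendieckTopology1969] A. Grothendieck, Hodge's general conjecture is false for trivial reasons, Topology 8
  (1969) 299–303, pp. 300–301.
* [Voisin2013GHCBloch] C. Voisin, The generalized Hodge and Bloch conjectures are equivalent for general complete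
  intersections, Ann. Sci. ÉNS 46 (2013), Lemma 2.1 (proof).
* [Voisin2025] C. Voisin, Hodge and generalized Hodge conjectures, coniveau and algebraic cycles, J. Open Math.
  Probl. 1 (2025), §4.3 (first paragraph), Prop. 4.8.
* [MurreTorino1994] J. P. Murre, Algebraic cycles and algebraic aspects of cohomology and K-theory, in: Algebraic
  Cycles and Hodge Theory (Torino 1993), LNM 1594 (1994), §5.7–§5.8.
* [VoisinHodgeI2002] C. Voisin, Hodge Theory and Complex Algebraic Geometry I (CUP 2002), §11.3 Thm. 11.30,
  §6.2.3 Thm. 6.25.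
-/

noncomputable section

open CategoryTheory AlgebraicGeometry MonoidalCategory CartesianMonoidalCategory Finset
open Literature.AlgebraicTopology.SingularHomology
open Literature.Geometry.Kaehler
open Literature.AlgebraicGeometry.Motives (IsSmoothProjective ComplexPoints)

namespace Literature.AlgebraicGeometry.HodgeTheory

variable {n : ℕ} {X : Motives.SchemeOver ℂ}

/-! ### §1 `GHC(X, 2q, q − 1) ⟹ GHC(X, 2q, q)` -/

/-- **`GHC(X, 2q, q − 1) ⟹ GHC(X, 2q, q)`: the sub-diagonal case of Grothendieck's amended conjecture implies the
Hodge conjecture in codimension `q`.** `max(X, 2q, q) ⊆ max(X, 2q, q − 1) ⊆ N^{q−1} H^{2q}` under the hypothesis,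
and `max(X, 2q, q) ∩ N^{q−1} ⊆ N^q` (the Hodge classes of coniveau `≥ q − 1` are algebraic).
[cite: GrothendieckTopology1969, pp. 300–301] [cite: Voisin2013GHCBloch, Lemma 2.1 (proof)] -/
theorem GeneralHodgePropertyFor.of_pred_level (hX : IsSmoothProjective n X) {p q : ℕ} (hq : p + 1 = q)
    (h : GeneralHodgePropertyFor n X (2 * q) p) : GeneralHodgePropertyFor n X (2 * q) q := by
  obtain ⟨A⟩ := h.1
  refine (generalHodgePropertyFor_iff_of_hodgeModel A hX (2 * q) q).2 ?_
  have h1 : A.maxRatSubHodgeInFilt (2 * q) q ≤ supportedClasses X (2 * q) p :=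
    (A.maxRatSubHodgeInFilt_mono (2 * q) (show p ≤ q by omega)).trans
      ((generalHodgePropertyFor_iff_of_hodgeModel A hX (2 * q) p).1 h)
  exact (le_inf le_rfl h1).trans (A.maxRatSubHodgeInFilt_inf_supportedClasses_le_algebraicClasses hX hq)

/-- **`GHC(X, 2p + 2, p)` for all `p` ⟹ `HC(X)`** (codimension `0` is free).
[cite: GrothendieckTopology1969, pp. 300–301] [cite: Voisin2013GHCBloch, Lemma 2.1 (proof)] -/
theorem hodgeConjectureFor_of_forall_generalHodgePropertyFor_pred (hX : IsSmoothProjective n X)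
    (h : ∀ p : ℕ, GeneralHodgePropertyFor n X (2 * (p + 1)) p) : HodgeConjectureFor n X := by
  refine hodgeConjectureFor_of_generalHodgePropertyFor fun q ↦ ?_
  cases q with
  | zero => exact generalHodgePropertyFor_two_mul_self_of_lefschetzRange hX (Or.inl (Nat.zero_le 1))
  | succ p => exact (h p).of_pred_level hX rfl

/-- **`GHC(X, 4, 1) ⟹ GHC(X, 4, 2)` — the Hodge conjecture for codimension-`2` cycles follows from Grothendieck's
conjecture in coniveau `1` on `H⁴(X)`**, for every smooth projective `X`. [cite: GrothendieckTopology1969, pp. 300–301]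
[cite: Voisin2013GHCBloch, Lemma 2.1 (proof)] -/
theorem generalHodgePropertyFor_four_two_of_four_one (hX : IsSmoothProjective n X)
    (h : GeneralHodgePropertyFor n X 4 1) : GeneralHodgePropertyFor n X 4 2 :=
  h.of_pred_level (q := 2) hX rfl

/-! ### §2 The off-diagonal lower window -/

/-- **GROTHENDIECK'S CONJECTURE FOR `X` IN ALL BIDEGREES ⟺ ITS OFF-DIAGONAL LOWER-WINDOW CASES** `1 ≤ r`,
`2r < i ≤ dim X`, `i < dim X + r`: the diagonal cells `(2r, r)` of the lower window
(`forall_generalHodgePropertyFor_iff_lower_window`) are Lefschetz `(1,1)` for `r = 1` and are implied by the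
off-diagonal cells `(2r, r − 1)` for `r ≥ 2` (§1) — the Hodge conjecture proper is never an independent case.
[cite: GrothendieckTopology1969, pp. 300–301] [cite: Voisin2025, §4.3 (first paragraph)]
[cite: Voisin2013GHCBloch, Lemma 2.1 (proof)] [cite: MurreTorino1994, §5.7–§5.8] -/
theorem forall_generalHodgePropertyFor_iff_offDiagonal_lower_window (hX : IsSmoothProjective n X) :
    (∀ i r : ℕ, GeneralHodgePropertyFor n X i r) ↔
      ∀ i r : ℕ, 1 ≤ r → 2 * r < i → i ≤ n → i < n + r → GeneralHodgePropertyFor n X i r := by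
  refine ⟨fun h i r _ _ _ _ ↦ h i r, fun h ↦ (forall_generalHodgePropertyFor_iff_lower_window hX).2 ?_⟩
  intro i r hr h2 hi hw
  rcases h2.lt_or_eq with hlt | heq
  · exact h i r hr hlt hi hw
  · subst heq
    rcases (show r = 1 ∨ 2 ≤ r by omega) with rfl | hr2
    · exact generalHodgePropertyFor_two_one hX
    · obtain ⟨p, rfl⟩ : ∃ p, r = p + 1 := ⟨r - 1, by omega⟩
      exact (h (2 * (p + 1)) p (by omega) (by omega) hi (by omega)).of_pred_level hX rfl

/-! ### §3 Fourfolds and fivefolds -/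

/-- **FOURFOLDS: Grothendieck's amended general Hodge conjecture in all bidegrees ⟺ `GHC(X, 3, 1) ∧ GHC(X, 4, 1)`**
(the prequel's `forall_generalHodgePropertyFor_dim_four_iff` had the third case `GHC(X, 4, 2)` — the Hodge
conjecture for codimension-`2` cycles on the fourfold — which is implied by `GHC(X, 4, 1)`).
[cite: GrothendieckTopology1969, pp. 300–301] [cite: Voisin2025, §4.3 (first paragraph) and Prop. 4.8]
[cite: Voisin2013GHCBloch, Lemma 2.1 (proof)] -/
theorem forall_generalHodgePropertyFor_dim_four_iff' (hX : IsSmoothProjective 4 X) :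
    (∀ i r : ℕ, GeneralHodgePropertyFor 4 X i r) ↔
      GeneralHodgePropertyFor 4 X 3 1 ∧ GeneralHodgePropertyFor 4 X 4 1 := by
  rw [forall_generalHodgePropertyFor_dim_four_iff hX]
  exact ⟨fun h ↦ ⟨h.1, h.2.1⟩, fun h ↦ ⟨h.1, h.2, generalHodgePropertyFor_four_two_of_four_one hX h.2⟩⟩

/-- **FOURFOLDS: `GHC(X, 4, 1) ⟹ HC(X)`** — on a smooth projective fourfold the Hodge conjecture is open only in
codimension `2` (`p ≤ 1` and `p ≥ 3` are in the Lefschetz range), and that case follows from Grothendieck's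
conjecture in coniveau `1` on `H⁴(X)`. [cite: GrothendieckTopology1969, pp. 300–301]
[cite: Voisin2013GHCBloch, Lemma 2.1 (proof)] [cite: VoisinHodgeI2002, §11.3 Thm. 11.30 and §6.2.3 Thm. 6.25] -/
theorem hodgeConjectureFor_of_generalHodgePropertyFor_four_one (hX : IsSmoothProjective 4 X)
    (h : GeneralHodgePropertyFor 4 X 4 1) : HodgeConjectureFor 4 X := by
  refine hodgeConjectureFor_of_generalHodgePropertyFor fun p ↦ ?_
  by_cases hp : p ≤ 1 ∨ 4 ≤ p + 1
  · exact generalHodgePropertyFor_two_mul_self_of_lefschetzRange hX hp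
  · obtain rfl : p = 2 := by omega
    exact generalHodgePropertyFor_four_two_of_four_one hX h

/-- **FIVEFOLDS: Grothendieck's amended general Hodge conjecture in all bidegrees ⟺
`GHC(X, 3, 1) ∧ GHC(X, 4, 1) ∧ GHC(X, 5, 1) ∧ GHC(X, 5, 2)`** (the off-diagonal lower window of a fivefold;
`(2, 1)` is Lefschetz `(1,1)`, `(4, 2)` follows from `(4, 1)`, the cells with `i > 5` are hard-Lefschetz images).
[cite: GrothendieckTopology1969, pp. 300–301] [cite: Voisin2025, §4.3 (first paragraph)]
[cite: Voisin2013GHCBloch, Lemma 2.1 (proof)] [cite: MurreTorino1994, §5.7–§5.8] -/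
theorem forall_generalHodgePropertyFor_dim_five_iff (hX : IsSmoothProjective 5 X) :
    (∀ i r : ℕ, GeneralHodgePropertyFor 5 X i r) ↔
      GeneralHodgePropertyFor 5 X 3 1 ∧ GeneralHodgePropertyFor 5 X 4 1 ∧ GeneralHodgePropertyFor 5 X 5 1 ∧
        GeneralHodgePropertyFor 5 X 5 2 := by
  refine ⟨fun h ↦ ⟨h 3 1, h 4 1, h 5 1, h 5 2⟩,
    fun h ↦ (forall_generalHodgePropertyFor_iff_offDiagonal_lower_window hX).2 fun i r hr h2 hi hw ↦ ?_⟩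
  obtain ⟨h31, h41, h51, h52⟩ := h
  -- the off-diagonal lower window of a fivefold: (3,1), (4,1), (5,1), (5,2)
  have hcases : (i = 3 ∧ r = 1) ∨ (i = 4 ∧ r = 1) ∨ (i = 5 ∧ r = 1) ∨ (i = 5 ∧ r = 2) := by omega
  rcases hcases with ⟨rfl, rfl⟩ | ⟨rfl, rfl⟩ | ⟨rfl, rfl⟩ | ⟨rfl, rfl⟩
  · exact h31
  · exact h41
  · exact h51
  · exact h52

/-- **FIVEFOLDS: `GHC(X, 4, 1) ⟹ HC(X)`** — on a smooth projective fivefold the Hodge conjecture is open in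
codimensions `2` and `3`; codimension `2` follows from `GHC(X, 4, 1)` (§1) and codimension `3` is its
hard-Lefschetz image (`GHC(X, 4, 2) ⟹ GHC(X, 6, 3)`, `generalHodgePropertyFor_of_add_eq_dim`).
[cite: GrothendieckTopology1969, pp. 300–301] [cite: Voisin2025, §4.3 (first paragraph)]
[cite: Voisin2013GHCBloch, Lemma 2.1 (proof)] [cite: VoisinHodgeI2002, §6.2.3 Thm. 6.25] -/
theorem hodgeConjectureFor_of_generalHodgePropertyFor_four_one_of_dim_five (hX : IsSmoothProjective 5 X)
    (h : GeneralHodgePropertyFor 5 X 4 1) : HodgeConjectureFor 5 X := by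
  have h42 : GeneralHodgePropertyFor 5 X 4 2 := generalHodgePropertyFor_four_two_of_four_one hX h
  refine hodgeConjectureFor_of_generalHodgePropertyFor fun p ↦ ?_
  by_cases hp : p ≤ 1 ∨ 5 ≤ p + 1
  · exact generalHodgePropertyFor_two_mul_self_of_lefschetzRange hX hp
  · rcases (show p = 2 ∨ p = 3 by omega) with rfl | rfl
    · exact h42
    · exact generalHodgePropertyFor_of_add_eq_dim hX (show 4 + 1 = 5 by rfl) h42

end Literature.AlgebraicGeometry.HodgeTheory

end
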